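import Summits.Ventures.QEC.Thresholds.HypergraphProductFamilyThresholds
import Summits.Ventures.QEC.Census.HGP.Core2
import Mathlib.LinearAlgebra.FiniteDimensional.Basic
import HarnessLib

/-!
# The TORIC codes as hypergraph products `HGP(circ_L, circ_L)` (census cell B.0): the circulant cycle-code seed,
# `k = 2`, sector distances `≥ L`, degrees `(2,2)`, and the census bridge at `L = 8`

Venture QEC, `Summits/Ventures/QEC/Thresholds/` (LADDER-QEC rung Q5, cell Q5.hgp; qec-type-09 gen 3, item 09.HGPTH,
"one B.0 seed pair"). CENSUS-PREREG B.0 registers the toric codes `[[2L², 2, L]]` AS HYPERGRAPH PRODUCTS of the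
circulant parity-check matrix `circ_L` of the cycle (repetition) code with itself (Kovalev–Pryadko 2012, Examples 2/6;
census rows `HGP_circ<L>h0.1_x_circ<L>h0.1`, seeds `rowMatrix L [..]` with row `i` = bits `{i-1, i}`). This file
defines that family PARAMETRICALLY — `cycMatrix k` (`L = k + 2 ≥ 2`; row `i` = `{i, i-1}`), `toricHGPCode k =
HGP.code (cycMatrix k) (cycMatrix k)` — and proves exactly the inputs the generic threshold pipeline of
`HypergraphProductFamilyThresholds.lean` consumes (the thresholds themselves: `ToricCodeHGPThresholds.lean`):

* `cycMatrix_mulVec_apply` / `cycMatrix_transpose_mulVec_apply` (`(Hx)_i = x_i + x_{i-1}`, `(Hᵀy)_j = y_j + y_{j+1}`),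
  kernels are the constants (`cycMatrix_ker_const`, `…_transpose_ker_const`), hence `d(ker H), d(ker Hᵀ) ≥ L`
  (`le_minDist_pcCode_cycMatrix`, `…_transpose`), `pcCode (cycMatrix k) = 𝔽₂ ∙ 𝟙`, `rank = L - 1` (`rank_cycMatrix`),
  degrees `(2,2)` (`cycMatrix_isDegreeBounded`);
* `toricHGPCode_k : (toricHGPCode k).k = 2` for EVERY `k` (Tillich–Zémor Thm 7 via `HGP.code_k_eq`) — NON-VACUITY:
  both sectors have logical operators (`toricHGPCode_dZ_pos`, `toricHGPCode_dX_pos`), and `L ≤ d^Z`, `L ≤ d^X`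
  (`toricHGPCode_le_dZ`, `toricHGPCode_le_dX`, Tillich–Zémor Thm 9);
* CENSUS BRIDGE: `cycMatrix_six_eq : cycMatrix 6 = rowMatrix 8 [129, 3, 6, 12, 24, 48, 96, 192]` (`decide`), so the
  `k = 6` member IS the census object of row `HGP_circ8h0.1_x_circ8h0.1` and `toricHGPCode_six_isCode :
  (toricHGPCode 6).IsCode 128 2 8` is type-04's kernel theorem re-addressed.

HONEST FRAMING: PROVED, kernel axioms, no named fact, no `native_decide`; `d^Z = d^X = L` exactly is not claimed
here for general `L` (only `≥ L`; the census rows certify equality size by size, e.g. `toricHGPCode_six_isCode`).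

## References

* [KovalevPryadko2012] A. A. Kovalev, L. P. Pryadko, ISIT 2012 = arXiv:1202.0928, eq. (7), Examples 2 and 6 (toric
  codes `[[2d², 2, d]]` as hypergraph products of circulant matrices).
* [TillichZemor2014] J.-P. Tillich, G. Zémor, IEEE Trans. IT 60 (2014) 1193, Thm 7, Thm 9, §3 (cycle codes).
* [BravyiEtAl2024] S. Bravyi et al., Nature 627 (2024) 778, §4 Lemma 1 (`k > 0`, `d^X`, `d^Z`).
-/

noncomputable section

namespace Summit.Ventures.QEC.Thresholds

open Finset Matrix
open Literature.InformationTheory.QuantumCodes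
open Literature.InformationTheory.Coding (minDist le_minDist_iff)

/-! ### The circulant parity-check matrix of the cycle code -/

/-- The **circulant parity-check matrix of the cycle (repetition) code of length `L = k + 2`**: check `i`
compares bits `i` and `i - 1 (mod L)` — the census seed `circ<L>h0.1` (row `i` = bit word `2^i + 2^{i-1 mod L}`).
[cite: KovalevPryadko2012, Example 2 (circulant matrix of the repetition code; arXiv chunk p0007)] -/
def cycMatrix (k : ℕ) : Matrix (Fin (k + 2)) (Fin (k + 2)) (ZMod 2) :=
  Matrix.of fun i j => if j = i ∨ j + 1 = i then 1 else 0

/-- `1 ≠ 0` in `Fin (k+2)`, i.e. `i ≠ i - 1` and `j ≠ j + 1`: the two entries of a row / column are distinct.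
[folklore] -/
private theorem fin_one_ne_zero (k : ℕ) : (1 : Fin (k + 2)) ≠ 0 := by
  intro h
  have := congrArg Fin.val h
  simp at this

/-- The cycle checks: `(H x)_i = x_i + x_{i-1}`. [cite: KovalevPryadko2012, Example 2 (repetition code checks)] -/
theorem cycMatrix_mulVec_apply (k : ℕ) (x : Fin (k + 2) → ZMod 2) (i : Fin (k + 2)) :
    (cycMatrix k *ᵥ x) i = x i + x (i - 1) := by
  classical
  have hne : i ≠ i - 1 := fun h => fin_one_ne_zero k (sub_eq_self.1 h.symm)
  simp only [mulVec, dotProduct, cycMatrix, of_apply]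
  have hre : ∀ j : Fin (k + 2), (if j = i ∨ j + 1 = i then (1 : ZMod 2) else 0) * x j =
      if j = i ∨ j + 1 = i then x j else 0 := by
    intro j
    split_ifs <;> simp
  rw [Finset.sum_congr rfl fun j _ => hre j, ← Finset.sum_filter]
  have hset : univ.filter (fun j : Fin (k + 2) => j = i ∨ j + 1 = i) = {i, i - 1} := by
    ext j
    simp only [Finset.mem_filter, Finset.mem_univ, true_and, Finset.mem_insert, Finset.mem_singleton,
      eq_sub_iff_add_eq]
  rw [hset, Finset.sum_pair hne]

/-- The transposed cycle checks: `(Hᵀ y)_j = y_j + y_{j+1}`. [cite: KovalevPryadko2012, Example 2 (repetition code checks)] -/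
theorem cycMatrix_transpose_mulVec_apply (k : ℕ) (y : Fin (k + 2) → ZMod 2) (j : Fin (k + 2)) :
    ((cycMatrix k)ᵀ *ᵥ y) j = y j + y (j + 1) := by
  classical
  have hne : j ≠ j + 1 := fun h => fin_one_ne_zero k (add_eq_left.1 h.symm)
  simp only [mulVec, dotProduct, transpose_apply, cycMatrix, of_apply]
  have hre : ∀ i : Fin (k + 2), (if j = i ∨ j + 1 = i then (1 : ZMod 2) else 0) * y i =
      if j = i ∨ j + 1 = i then y i else 0 := by
    intro i
    split_ifs <;> simp
  rw [Finset.sum_congr rfl fun i _ => hre i, ← Finset.sum_filter]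
  have hset : univ.filter (fun i : Fin (k + 2) => j = i ∨ j + 1 = i) = {j, j + 1} := by
    ext i
    simp only [Finset.mem_filter, Finset.mem_univ, true_and, Finset.mem_insert, Finset.mem_singleton]
    constructor
    · rintro (h | h)
      · exact Or.inl h.symm
      · exact Or.inr h.symm
    · rintro (h | h)
      · exact Or.inl h.symm
      · exact Or.inr h.symm
  rw [hset, Finset.sum_pair hne]

/-- A vector on the cycle with `x_{i+1} = x_i` for all `i` is constant. [folklore] -/
theorem eq_apply_zero_of_forall_succ {k : ℕ} {x : Fin (k + 2) → ZMod 2} (h : ∀ i, x (i + 1) = x i)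
    (j : Fin (k + 2)) : x j = x 0 := by
  induction j using Fin.induction with
  | zero => rfl
  | succ i ih => rw [← Fin.coeSucc_eq_succ, h, ih]

/-- **A cycle of the cycle code is constant** (`ker H = {0, 𝟙}`). [cite: TillichZemor2014, §3 (the cycle code of a cycle graph)] -/
theorem cycMatrix_ker_const {k : ℕ} {x : Fin (k + 2) → ZMod 2} (hx : cycMatrix k *ᵥ x = 0) (j : Fin (k + 2)) :
    x j = x 0 := by
  refine eq_apply_zero_of_forall_succ (fun i => ?_) j
  have h := congrFun hx (i + 1)
  rw [cycMatrix_mulVec_apply, Pi.zero_apply, add_sub_cancel_right] at h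
  have key : ∀ a b : ZMod 2, a + b = 0 → a = b := by decide
  exact key _ _ h

/-- `ker Hᵀ` of the circulant cycle matrix also consists of the constants (the row dependencies: all rows sum to
`0`). [cite: TillichZemor2014, §3 (cycle codes; the transpose hypergraph)] -/
theorem cycMatrix_transpose_ker_const {k : ℕ} {y : Fin (k + 2) → ZMod 2} (hy : (cycMatrix k)ᵀ *ᵥ y = 0)
    (j : Fin (k + 2)) : y j = y 0 := by
  refine eq_apply_zero_of_forall_succ (fun i => ?_) j
  have h := congrFun hy i
  rw [cycMatrix_transpose_mulVec_apply, Pi.zero_apply] at h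
  have key : ∀ a b : ZMod 2, a + b = 0 → b = a := by decide
  exact key _ _ h

/-- A non-zero constant vector on `L = k+2` points has weight `L`. [folklore] -/
theorem hammingNorm_eq_of_const {k : ℕ} {x : Fin (k + 2) → ZMod 2} (hc : ∀ j, x j = x 0) (hx0 : x ≠ 0) :
    hammingNorm x = k + 2 := by
  have h0 : x 0 ≠ 0 := fun h0 => hx0 (funext fun j => by rw [hc j, h0, Pi.zero_apply])
  unfold hammingNorm
  rw [Finset.filter_true_of_mem fun j _ => by rw [hc j]; exact h0, Finset.card_univ, Fintype.card_fin]

/-- **The cycle code of length `L` has distance `≥ L`** (`d(ker circ_L) ≥ L`; in fact `= L`).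
[cite: KovalevPryadko2012, Example 2 (the repetition code [d, 1, d])] -/
theorem le_minDist_pcCode_cycMatrix (k : ℕ) : ((k + 2 : ℕ) : ℕ∞) ≤ minDist (pcCode (cycMatrix k)) := by
  rw [le_minDist_iff]
  intro c hc hc0
  exact_mod_cast (hammingNorm_eq_of_const (cycMatrix_ker_const ((mem_pcCode_iff _ _).1 hc)) hc0).ge

/-- **The transpose code also has distance `≥ L`** (`d(ker circ_Lᵀ) ≥ L`: square circulant seed, `dᵀ = d`).
[cite: KovalevPryadko2012, Example 6 (square circulant matrices, d̃ = d)] -/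
theorem le_minDist_pcCode_cycMatrix_transpose (k : ℕ) :
    ((k + 2 : ℕ) : ℕ∞) ≤ minDist (pcCode (cycMatrix k)ᵀ) := by
  rw [le_minDist_iff]
  intro c hc hc0
  exact_mod_cast (hammingNorm_eq_of_const (cycMatrix_transpose_ker_const ((mem_pcCode_iff _ _).1 hc)) hc0).ge

/-- Row weights `≤ 2` (row `i` is supported on `{i, i-1}`). [cite: KovalevPryadko2012, Example 2 (weight-2 circulant rows)] -/
theorem hammingNorm_cycMatrix_row_le (k : ℕ) (i : Fin (k + 2)) : hammingNorm (cycMatrix k i) ≤ 2 := by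
  classical
  refine (HypergraphProduct.hammingNorm_le_card_of_subset (cycMatrix k i) {i, i - 1} fun j hj => ?_).trans
    Finset.card_le_two
  rw [Finset.mem_insert, Finset.mem_singleton]
  by_contra hmem
  apply hj
  simp only [cycMatrix, of_apply]
  rw [if_neg]
  rintro (h | h)
  · exact hmem (Or.inl h)
  · exact hmem (Or.inr (eq_sub_of_add_eq h))

/-- Column weights `≤ 2` (bit `j` lies in checks `j` and `j+1`). [cite: KovalevPryadko2012, Example 2 (weight-2 circulant columns)] -/
theorem hammingNorm_cycMatrix_col_le (k : ℕ) (j : Fin (k + 2)) : hammingNorm (fun i => cycMatrix k i j) ≤ 2 := by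
  classical
  refine (HypergraphProduct.hammingNorm_le_card_of_subset (fun i => cycMatrix k i j) {j, j + 1}
    fun i hi => ?_).trans Finset.card_le_two
  rw [Finset.mem_insert, Finset.mem_singleton]
  by_contra hmem
  apply hi
  simp only [cycMatrix, of_apply]
  rw [if_neg]
  rintro (h | h)
  · exact hmem (Or.inl h.symm)
  · exact hmem (Or.inr h.symm)

/-- The circulant cycle matrices are `(2,2)`-bounded (degrees `Δ_q = Δ_c = 2`).
[cite: KovalevPryadko2012, Example 2 (weight-2 circulant matrix)] -/
theorem cycMatrix_isDegreeBounded (k : ℕ) : IsDegreeBounded (cycMatrix k) 2 2 :=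
  ⟨hammingNorm_cycMatrix_col_le k, hammingNorm_cycMatrix_row_le k⟩

/-- `ker circ_L = 𝔽₂ ∙ 𝟙` (the constants). [cite: TillichZemor2014, §3 (the cycle code of a connected graph with one cycle... here the L-cycle: dimension 1)] -/
theorem pcCode_cycMatrix_eq_span (k : ℕ) :
    pcCode (cycMatrix k) = Submodule.span (ZMod 2) {fun _ : Fin (k + 2) => (1 : ZMod 2)} := by
  apply le_antisymm
  · intro x hx
    have hconst := cycMatrix_ker_const ((mem_pcCode_iff _ _).1 hx)
    rw [Submodule.mem_span_singleton]
    exact ⟨x 0, funext fun j => by rw [Pi.smul_apply, smul_eq_mul, mul_one, hconst j]⟩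
  · rw [Submodule.span_le, Set.singleton_subset_iff, SetLike.mem_coe, mem_pcCode_iff]
    funext i
    rw [cycMatrix_mulVec_apply, Pi.zero_apply]
    decide

/-- `dim ker circ_L = 1`. [cite: TillichZemor2014, §3 (dimension of the cycle code)] -/
theorem finrank_pcCode_cycMatrix (k : ℕ) : Module.finrank (ZMod 2) (pcCode (cycMatrix k)) = 1 := by
  rw [pcCode_cycMatrix_eq_span, finrank_span_singleton]
  intro h
  have := congrFun h 0
  simp at this

/-- **`rank circ_L = L - 1`.** [cite: KovalevPryadko2012, Example 6 (κ = κ̃ = 1 for the circulant repetition matrices)] -/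
theorem rank_cycMatrix (k : ℕ) : (cycMatrix k).rank = k + 1 := by
  have h := rank_add_finrank_pcCode (cycMatrix k)
  rw [finrank_pcCode_cycMatrix, Fintype.card_fin] at h
  omega

/-! ### The toric codes as hypergraph products -/

/-- **The toric code of linear size `L = k+2` as the census hypergraph product `HGP(circ_L, circ_L)`**
(`2L²` qubits `(Fin L × Fin L) ⊕ (Fin L × Fin L)`, `L²` `X`-checks, `L²` `Z`-checks). Definition (reducible).
[cite: KovalevPryadko2012, Examples 2 and 6 (toric codes [[2d², 2, d]] as hypergraph products of circulant matrices)] -/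
abbrev toricHGPCode (k : ℕ) : CSSCode (Fin (k + 2) × Fin (k + 2)) (Fin (k + 2) × Fin (k + 2))
    ((Fin (k + 2) × Fin (k + 2)) ⊕ (Fin (k + 2) × Fin (k + 2))) :=
  HGP.code (cycMatrix k) (cycMatrix k)

/-- **`k = 2` logical qubits for every `L`** (Tillich–Zémor Thm 7: `(L-(L-1))² + (L-(L-1))² = 2`) — in particular
neither sector is empty. [cite: TillichZemor2014, Thm 7] [cite: KovalevPryadko2012, Example 6 ([[2d², 2, d]])] -/
theorem toricHGPCode_k (k : ℕ) : (toricHGPCode k).k = 2 := by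
  rw [toricHGPCode, HGP.code_k_eq _ _ (rank_cycMatrix k) (rank_cycMatrix k)]
  have h1 : k + 2 - (k + 1) = 1 := by omega
  rw [h1]

/-- Non-vacuity, `Z`-sector: a `Z`-logical exists (`d^Z > 0`). [cite: BravyiEtAl2024, §4 Lemma 1 (k > 0 ⇒ logical operators)] -/
theorem toricHGPCode_dZ_pos (k : ℕ) : 0 < (toricHGPCode k).dZ :=
  (toricHGPCode k).dZ_pos_of_k_pos (by rw [toricHGPCode_k]; norm_num)

/-- Non-vacuity, `X`-sector: an `X`-logical exists (`d^X > 0`). [cite: BravyiEtAl2024, §4 Lemma 1 (k > 0 ⇒ logical operators)] -/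
theorem toricHGPCode_dX_pos (k : ℕ) : 0 < (toricHGPCode k).dX :=
  (toricHGPCode k).dX_pos_of_k_pos (by rw [toricHGPCode_k]; norm_num)

/-- **`d^Z ≥ L`** (Tillich–Zémor Thm 9 with `d(ker circ_L) , d(ker circ_Lᵀ) ≥ L`). [cite: TillichZemor2014, Thm 9] -/
theorem toricHGPCode_le_dZ (k : ℕ) : k + 2 ≤ (toricHGPCode k).dZ :=
  (toricHGPCode k).le_dZ ((toricHGPCode k).dZ_pos_iff.1 (toricHGPCode_dZ_pos k)) fun x hx hxS =>
    hgp_le_weight_zLogical _ _ (le_minDist_pcCode_cycMatrix k) (le_minDist_pcCode_cycMatrix_transpose k) x hx hxS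

/-- **`d^X ≥ L`** (Tillich–Zémor Thm 9, cocycle half). [cite: TillichZemor2014, Thm 9] -/
theorem toricHGPCode_le_dX (k : ℕ) : k + 2 ≤ (toricHGPCode k).dX :=
  (toricHGPCode k).le_dX ((toricHGPCode k).dX_pos_iff.1 (toricHGPCode_dX_pos k)) fun x hx hxS =>
    hgp_le_weight_xLogical _ _ (le_minDist_pcCode_cycMatrix_transpose k) (le_minDist_pcCode_cycMatrix k) x hx hxS

/-- **Census bridge**: the `L = 8` member of the parametric family IS the registered census seed `circ8h0.1`
(`rowMatrix 8 [129, 3, 6, 12, 24, 48, 96, 192]`), checked entrywise by `decide`. [cite: KovalevPryadko2012, Example 2 (circulant repetition matrix)] -/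
theorem cycMatrix_six_eq : cycMatrix 6 = Census.rowMatrix 8 [129, 3, 6, 12, 24, 48, 96, 192] := by
  decide

/-- The `L = 8` toric code of this family is the census row `HGP_circ8h0.1_x_circ8h0.1 = [[128, 2, 8]]` (type-04's
kernel theorem `Census.HGP.isCode_HGP_circ8h0_1_x_circ8h0_1`, exact distance). [cite: KovalevPryadko2012, Examples 2 and 6 ([[2d², 2, d]] at d = 8)] -/
theorem toricHGPCode_six_isCode : (toricHGPCode 6).IsCode 128 2 8 := by
  rw [toricHGPCode, cycMatrix_six_eq]
  exact Census.HGP.isCode_HGP_circ8h0_1_x_circ8h0_1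

end Summit.Ventures.QEC.Thresholds
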